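import Literature.Barriers.CriticalPhenomena.LongRangeTrivialityOnZ3LeftContinuity
import Literature.Probability.LatticeModels.SharpnessProofs
import Mathlib.Analysis.PSeries
import Mathlib.Analysis.SpecialFunctions.Pow.Integral
import Mathlib.Analysis.SpecialFunctions.ImproperIntegrals
import Mathlib.MeasureTheory.Integral.Pi

/-!
# Panis's infrared bound for algebraically decaying couplings, reduced to Proposition 3.8's first
# display (kernel form): `Ĵ(p)`, the Fourier lower bound `1 - Ĵ(p) ≳ |p|^{α∧2}` (PROVED), and the assembly

Sibling of `Literature/Barriers/CriticalPhenomena/LongRangeTrivialityOnZ3.lean` (barrier catalogue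
D-0021, sub-problem `Ising3DConformalLimit`), first layer under the named fact
`Literature.Barriers.CriticalPhenomena.panis_infraredBound_algebraic` of `…TwoPoint.lean` — Panis,
*Triviality of the scaling limits of critical Ising and `φ⁴` models with effective dimension at least
four*, arXiv:2309.05797 = Ann. Probab. 54 (2026), §3.6, the display "there exists `C = C(d) > 0` such
that for all `β ≤ β_c(ρ)`, for all `x ∈ ℤ^d∖{0}`, `⟨τ₀τ_x⟩_{ρ,β} ≤ C/β_c(ρ) |x|^{-(d-α∧2)}(log|x|)^{δ_{α,2}}`"
for reflection-positive couplings with `∑_{|x|=k}J_{0,x} ≍ k^{-1-α}` ("Using Proposition 3.8 we get…").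

## The printed derivation (§3.3, pp. 13–16 of the arXiv version) and what is done here

Proposition 3.8 (`d ≥ 3`, RP models, (A1)–(A5)): for every `β ≤ β_c(ρ)` and `x ≠ 0`,
`S_{ρ,β}(x) ≤ C/(β|J||x|^d) ∫_{(-π|x|,π|x|]^d} e^{-‖p‖₂²}/(1 - Ĵ(p/|x|)) dp` (first display; from the
Messager–Miracle-Solé inequalities, `χ_L ≤ C₃L^d∫e^{-L²‖p‖₂²}Ŝ_β(p)dp`, and Proposition 3.7 — the
infinite-volume infrared bound `Ŝ_β(p) ≤ 1/(2β|J|(1-Ĵ(p)))` for `β < β_c`, itself resting on the torus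
Gaussian domination Prop. 3.4 [FSS, FILS], the uniqueness of the state and `∑_xS_β(x) < ∞` below `β_c`
[ABF 1987], and the Simon–Lieb inequality); then "the decay of the two-point function is governed by
the behaviour of `1 - Ĵ(p)` as `p` goes to `0`": for power-law couplings `1 - Ĵ(p) ≍ |p|^{α∧2}`
(`α ≠ 2`), whence `⟨τ₀τ_x⟩_{ρ,β} ≤ C/(β|J|)|x|^{-(d-α∧2)}` (display before Remark 3.9), and the §3.6 form
with `1/β_c` by monotonicity in `β`.

This file (all PROVED except the one named fact marked FACT, `panis_prop38_kernelForm`, which is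
DISCHARGED downstream: `panis_prop38_kernelForm_holds`, `LongRangeTrivialityOnZ3InfraredBoundKernel.lean`):

* `LongRangeIsing.couplingNorm J = |J| = ∑_x J_{0,x}`, `LongRangeIsing.phase p x = p·x`,
  `LongRangeIsing.couplingFourier J p = Ĵ(p) = ∑_x cos(p·x)J_{0,x}/|J|` (real form of the printed
  `∑_x e^{ip·x}J_{0,x}/|J|`); for `J_{x,y} = C₀|x-y|₁^{-d-α}`: summability of `J_{0,·}` (lattice
  `p`-series), `|J| ≥ C₀ > 0`, `Ĵ(0) = 1`, `0 ≤ 1 - Ĵ`, continuity of `Ĵ`, Remark 3.5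
  (`1 - Ĵ(p) = ∑_x(1 - cos(p·x))J_{0,x}/|J|`);
* GKS: `β ↦ ⟨σ_xσ_y⟩_β` nondecreasing, used through `state_spinProduct_mono_beta` of
  `LongRangeTrivialityOnZ3LeftContinuity.lean` (also `pairCorrelation_mono_beta` of `…InputsProofs`);
* FACT `panis_prop38_kernelForm` — Proposition 3.8's first display for the algebraic family, with the
  printed Gaussian weight `e^{-‖p‖₂²}` replaced by the larger product kernel `W(p) = ∏ᵢ(1 ∨ pᵢ²)⁻¹`
  (`exp_neg_sum_sq_le_envelope`): formally WEAKER than the printed display, and the form that a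
  Fejér-kernel proof of Proposition 3.8 yields directly — DISCHARGED that way, for every `α > 0`, in
  `LongRangeTrivialityOnZ3InfraredBoundKernel.lean` (`panis_prop38_kernelForm_holds`, torus route). The
  printed Gaussian-weight display is deliberately NOT vendored as a separate named fact (D-0026 split
  review, 2026-08-15): it has no user — `panis_infraredBound_algebraic` is discharged in
  `LongRangeTrivialityOnZ3InfraredBoundHolds.lean` without it — and, its constant `C = C(d)` being
  existential, it carries nothing beyond the kernel form. (Remark, not formalized: `1/(1 - Ĵ)` is positive
  definite — for `d ≥ 3` it is the Fourier transform of the Green function `∑_{t≥0}(J_{0,·}/|J|)^{*t} ≥ 0` —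
  so the unit-cell integrals `∫_{m+[-½,½)^d} dp/(1 - Ĵ(p/|x|))`, `m ∈ ℤ^d`, are bounded uniformly in `m` by
  `C(d)∫_{[-2,2]^d} dp/(1 - Ĵ(p/|x|))`; with `W(p) ≤ (9/4)^d W(m)` on the cell of `m` and `∑_m W(m) ≤ 5^d`
  this gives `∫ W/(1 - Ĵ(·/|x|)) ≤ C'(d) ∫ e^{-‖p‖₂²}/(1 - Ĵ(p/|x|)) dp` over `(-π|x|,π|x|]^d`, i.e. the two
  forms of the display are equivalent up to the constant.)
* `panis_couplingFourierGap_lower` — the lower half of "`1 - Ĵ(p) ≍ |p|^{α∧2}` as `p → 0`", vendored as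
  a named fact for the record and DISCHARGED (`panis_couplingFourierGap_lower_holds`): for `α > 2` by
  the nearest-neighbour terms and Jordan's inequality (`1 - Ĵ(q) ≥ (2C₀/π²|J|)‖q‖_∞²` on the cube), for
  `α < 2` by a lattice-point count (with `s = ‖p‖_∞`, `k = ⌈π/s⌉`, pair the `≥ k^d` sites `x` of
  `[1,k]×[-k,k]^{d-1}` with `x + ke_j`: `(1-cos(p·x)) + (1-cos(p·x+kp_j)) ≥ 1` since `kp_j ∈ ±[π,π+1]`,
  and `J_{0,·} ≥ C₀((d+1)k)^{-d-α}` there);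
* the analysis of the assembly: the global lower bound `1 - Ĵ(q) ≥ c'‖q‖^{α∧2}` on `‖q‖_∞ ≤ π`, the
  pointwise bound `N/(1-Ĵ(p/|x|)) ≤ (|x|^a/c') N ‖p‖^{-a}` on the box, and
  `∫_{ℝ^d} W(p)‖p‖_∞^{-a}dp < ∞` for `0 ≤ a < d` (local integrability of `‖p‖^{-a}`, Mathlib's
  `integrableOn_ball_of_norm_le_rpow`, and `W ≤ ∏ 2(1+pᵢ²)⁻¹`);
* PROVED implications: `panis_infraredBound_algebraic_beta_of_kernelForm` (the §3.3 display with `1/β`,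
  vendored as `panis_infraredBound_algebraic_beta`), `panis_infraredBound_algebraic_of_beta` (the §3.6
  form by monotonicity in `β`; vacuous if `β_c = 0`), and the headline
  **`panis_infraredBound_algebraic_of_kernelForm : panis_prop38_kernelForm → panis_infraredBound_algebraic`**
  (used by `LongRangeTrivialityOnZ3InfraredBoundFourier.lean`). The inputs of Proposition 3.8 itself
  (MMS = the tree's `panis_mms_two_point_monotone`, Gaussian domination on the torus, the behaviour at and
  below `β_c`) are the next layers (`…InfraredBoundFourier`, `…InfraredBoundHolds`, `…InfraredBoundKernel`).

Tree anchors: `state_spinProduct_mono_beta` (`LongRangeTrivialityOnZ3LeftContinuity.lean`, GKS II in `β`),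
the GKS bridge of `LongRangeTrivialityOnZ3Proofs.lean` (`tendsto_expectIn_box`, `algebraicCoupling_nonneg`), the sup-norm spheres of `SharpnessProofs.lean`
(`Site.supNorm`, `sphere`, `card_sphere_succ_le`; the lattice `p`-series is re-proved locally rather than
importing `MagnetizationExponentUpper.lean`), Mathlib's `integrableOn_ball_of_norm_le_rpow`,
`integrable_inv_one_add_sq`, `Integrable.fintype_prod`, `continuous_tsum`, `Real.mul_le_sin` (Jordan),
`Real.cos_add_cos`. The lattice Fourier toolkit of the lace-expansion files (`kdot`, `latticeFT`, `cube`,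
`integral_cexp_kdot_mul_latticeFT` in `LaceExpansionPcInputs.lean`) is the natural tool for the next
layer (Parseval on `[-π,π]^d`); it is not imported here to keep the long-range Ising chain independent of
the percolation stack.

Conventions: momenta `p : Fin d → ℝ` with the sup norm `‖p‖` (all finite-dimensional norms being
equivalent, constants absorb the choice; the Gaussian is written `exp(-∑ᵢpᵢ²)` as printed), Lebesgue
(`volume`) integrals over the box `Set.pi univ (fun _ => Ioc (-π|x|) (π|x|))`, `|x| = ‖x‖_∞` for sites
(`Site.norm_eq_supNorm`), `|J|` absorbed into constants (it depends on `d, C₀, α` only).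

## References

* R. Panis, arXiv:2309.05797 (2023) = Ann. Probab. 54 (2026): §3 (notation `S_{ρ,β}`, `χ_L`, `|J|`),
  Prop. 3.4, Remark 3.5, Lemma 3.6, Prop. 3.7, Prop. 3.8 and its proof, the two displays before
  Remark 3.9, Remark 3.9, §3.6 (display after (3.x) "decay algebraic on slices") [Panis2023Triviality]
  (held as TeX-derived text `paper:arxiv-2309.05797`, chunks 13–16 read).
* J. Fröhlich, B. Simon, T. Spencer, CMP 50 (1976); J. Fröhlich, R. Israel, E. Lieb, B. Simon, CMP 62
  (1978); M. Aizenman, D. Barsky, R. Fernández, J. Stat. Phys. 47 (1987); A. Messager,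
  S. Miracle-Solé, J. Stat. Phys. 17 (1977) — as cited there (not consulted).
* S. Friedli, Y. Velenik, *Statistical Mechanics of Lattice Systems* (2017), §3.8.1 (GKS) [FriedliVelenik2017].
-/

noncomputable section

namespace Literature.Barriers.CriticalPhenomena

open Literature.Probability.LatticeModels Literature.Probability.Percolation Filter Topology Finset
open _root_.MeasureTheory _root_.Set
open scoped symmDiff

namespace LongRangeIsing

variable {d : ℕ}

/-! ### `|J|`, `p·x`, `Ĵ(p)` -/

/-- `|J| := ∑_{x ∈ ℤ^d} J_{0,x}`. [cite: Panis2023Triviality, §3 ("recall that |J| = ∑_x J_{0,x}")] -/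
def couplingNorm (J : Site d → Site d → ℝ) : ℝ := ∑' x : Site d, J 0 x

/-- The phase `p·x = ∑ᵢ pᵢ xᵢ` of a lattice site at momentum `p ∈ ℝ^d` (the same expression as
`Literature.Barriers.CriticalPhenomena.kdot` of `GaussianDominationRoute.lean`, kept local so that the
long-range Ising files do not import the percolation stack). [folklore] -/
def phase (p : Fin d → ℝ) (x : Site d) : ℝ := ∑ i, p i * (x i : ℝ)

/-- `Ĵ(p) := ∑_{x∈ℤ^d} e^{ip·x} J_{0,x}/|J|`, in real form `∑_x cos(p·x) J_{0,x}/|J|` (the imaginary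
part vanishes for an even `J_{0,·}`). [cite: Panis2023Triviality, Proposition 3.4 (definition of Ĵ)] -/
def couplingFourier (J : Site d → Site d → ℝ) (p : Fin d → ℝ) : ℝ :=
  (∑' x : Site d, Real.cos (phase p x) * J 0 x) / couplingNorm J


/-! ### The lattice `p`-series `∑_{x∈ℤ^d} ‖x‖_∞^{-s} < ∞` (`s > d`) -/

section LatticeSeries

/-- A box is the disjoint union of the spheres `‖x‖_∞ = n`, `n ≤ L` (shell decomposition of box sums;
the same statement as `Literature.Probability.LatticeModels.sum_box_eq_sum_range_sum_sphere` of
`SusceptibilityMeanFieldBound.lean`, kept local to avoid a heavy cross-import). [folklore] -/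
private theorem sum_box_eq_sum_range_sphere (L : ℕ) (f : Site d → ℝ) :
    ∑ x ∈ box d L, f x = ∑ n ∈ Finset.range (L + 1), ∑ x ∈ sphere d n, f x := by
  rw [← Finset.sum_fiberwise_of_maps_to (s := box d L) (t := Finset.range (L + 1))
    (g := Site.supNorm) (f := f) fun x hx =>
      Finset.mem_range.2 (Nat.lt_succ_of_le (mem_box_iff_supNorm_le.1 hx))]
  refine Finset.sum_congr rfl fun n hn => ?_
  have hfib : (box d L).filter (fun x => Site.supNorm x = n) = sphere d n := by
    ext x
    simp only [Finset.mem_filter, mem_box_iff_supNorm_le, mem_sphere]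
    have hn' : n ≤ L := Nat.le_of_lt_succ (Finset.mem_range.1 hn)
    constructor
    · exact fun h => h.2
    · intro h; exact ⟨h ▸ hn', h⟩
  rw [hfib]

/-- Shell bound for the lattice `p`-series: for `d ≥ 1` and `s > d`, every finite partial sum of
`Σ_{x ∈ ℤ^d} ‖x‖_∞^{-s}` is at most `2d·3^{d-1} Σ_{k ≥ 0} (k+1)^{d-1-s}` (`|∂Λ_{k+1}| ≤ 2d(2k+3)^{d-1}`,
the origin contributes `0^{-s} = 0`; same argument as `Literature.Probability.LatticeModels.sum_norm_rpow_neg_le`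
of `MagnetizationExponentUpper.lean`, kept local to avoid a heavy cross-import). [folklore] -/
private theorem sum_site_norm_rpow_neg_le (hd : 1 ≤ d) {s : ℝ} (hs : (d : ℝ) < s) (S : Finset (Site d)) :
    ∑ x ∈ S, ‖x‖ ^ (-s) ≤
      2 * d * (3 : ℝ) ^ (d - 1) * ∑' k : ℕ, ((k + 1 : ℕ) : ℝ) ^ ((d : ℝ) - 1 - s) := by
  have hs0 : 0 < s := lt_of_le_of_lt (Nat.cast_nonneg d) hs
  have hsum : Summable fun k : ℕ => ((k + 1 : ℕ) : ℝ) ^ ((d : ℝ) - 1 - s) := by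
    have h := (Real.summable_nat_rpow (p := (d : ℝ) - 1 - s)).2 (by linarith)
    exact (summable_nat_add_iff 1).2 h
  have hnn : ∀ x : Site d, 0 ≤ ‖x‖ ^ (-s) := fun x => Real.rpow_nonneg (norm_nonneg _) _
  have hexp : ∀ k : ℕ, ((k + 1 : ℕ) : ℝ) ^ (d - 1) * ((k + 1 : ℕ) : ℝ) ^ (-s) =
      ((k + 1 : ℕ) : ℝ) ^ ((d : ℝ) - 1 - s) := fun k => by
    have hk : (0 : ℝ) < ((k + 1 : ℕ) : ℝ) := by positivity
    rw [← Real.rpow_natCast, ← Real.rpow_add hk, Nat.cast_sub hd]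
    push_cast
    ring_nf
  set L : ℕ := S.sup Site.supNorm with hL
  have hSL : S ⊆ box d L := fun x hx =>
    mem_box_iff_supNorm_le.2 (Finset.le_sup (f := Site.supNorm) hx)
  calc ∑ x ∈ S, ‖x‖ ^ (-s) ≤ ∑ x ∈ box d L, ‖x‖ ^ (-s) :=
        Finset.sum_le_sum_of_subset_of_nonneg hSL fun x _ _ => hnn x
    _ = ∑ n ∈ Finset.range (L + 1), ∑ x ∈ sphere d n, ‖x‖ ^ (-s) := sum_box_eq_sum_range_sphere L _
    _ = ∑ n ∈ Finset.range (L + 1), (#(sphere d n) : ℝ) * (n : ℝ) ^ (-s) := by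
        refine Finset.sum_congr rfl fun n _ => ?_
        rw [Finset.sum_congr rfl fun x hx => by rw [Site.norm_eq_supNorm, mem_sphere.1 hx],
          Finset.sum_const, nsmul_eq_mul]
    _ = ∑ k ∈ Finset.range L, (#(sphere d (k + 1)) : ℝ) * ((k + 1 : ℕ) : ℝ) ^ (-s) := by
        rw [Finset.sum_range_succ']
        simp [Real.zero_rpow (neg_ne_zero.2 hs0.ne')]
    _ ≤ ∑ k ∈ Finset.range L,
          2 * d * (3 : ℝ) ^ (d - 1) * ((k + 1 : ℕ) : ℝ) ^ ((d : ℝ) - 1 - s) := by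
        refine Finset.sum_le_sum fun k _ => ?_
        have hk : (0 : ℝ) < ((k + 1 : ℕ) : ℝ) := by positivity
        have hcard := card_sphere_succ_le (d := d) k
        have h3 : (2 * k + 3 : ℝ) ^ (d - 1) ≤ (3 * ((k + 1 : ℕ) : ℝ)) ^ (d - 1) :=
          pow_le_pow_left₀ (by positivity) (by push_cast; linarith) _
        calc (#(sphere d (k + 1)) : ℝ) * ((k + 1 : ℕ) : ℝ) ^ (-s)
            ≤ 2 * d * (3 * ((k + 1 : ℕ) : ℝ)) ^ (d - 1) * ((k + 1 : ℕ) : ℝ) ^ (-s) :=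
              mul_le_mul_of_nonneg_right (hcard.trans (by gcongr)) (Real.rpow_nonneg hk.le _)
          _ = 2 * d * (3 : ℝ) ^ (d - 1) *
                (((k + 1 : ℕ) : ℝ) ^ (d - 1) * ((k + 1 : ℕ) : ℝ) ^ (-s)) := by
              rw [mul_pow]; ring
          _ = 2 * d * (3 : ℝ) ^ (d - 1) * ((k + 1 : ℕ) : ℝ) ^ ((d : ℝ) - 1 - s) := by
              rw [hexp k]
    _ = 2 * d * (3 : ℝ) ^ (d - 1) *
          ∑ k ∈ Finset.range L, ((k + 1 : ℕ) : ℝ) ^ ((d : ℝ) - 1 - s) := by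
        rw [Finset.mul_sum]
    _ ≤ 2 * d * (3 : ℝ) ^ (d - 1) * ∑' k : ℕ, ((k + 1 : ℕ) : ℝ) ^ ((d : ℝ) - 1 - s) := by
        refine mul_le_mul_of_nonneg_left ?_ (by positivity)
        exact hsum.sum_le_tsum _ fun k _ => Real.rpow_nonneg (by positivity) _

/-- **Lattice `p`-series**: `Σ_{x ∈ ℤ^d} ‖x‖_∞^{-s}` converges for `s > d` (`d ≥ 1`) (same statement as
`Literature.Probability.LatticeModels.summable_norm_rpow_neg`; Mathlib's `ZLattice.summable_norm_rpow` is
the abstract-lattice version). [folklore] -/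
private theorem summable_site_norm_rpow_neg (hd : 1 ≤ d) {s : ℝ} (hs : (d : ℝ) < s) :
    Summable fun x : Site d => ‖x‖ ^ (-s) :=
  summable_of_sum_le (fun _ => Real.rpow_nonneg (norm_nonneg _) _) (sum_site_norm_rpow_neg_le hd hs)

end LatticeSeries

/-! ### The algebraically decaying coupling: size, summability, `|J| > 0` -/

section Algebraic

/-- `|-x|₁ = |x|₁`. [folklore] -/
private theorem l1Norm_neg_eq (x : Site d) : l1Norm (-x) = l1Norm x := by
  simp [l1Norm]

/-- `|x|_∞ ≤ |x|₁`. [folklore] -/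
private theorem supNorm_le_l1Norm_site (x : Site d) : Site.supNorm x ≤ l1Norm x := by
  rw [Site.supNorm_le_iff]
  intro i
  exact Finset.single_le_sum (f := fun j => (x j).natAbs) (fun _ _ => Nat.zero_le _) (Finset.mem_univ i)

/-- `|eᵢ|₁ = 1`. [folklore] -/
private theorem l1Norm_single_one (i : Fin d) : l1Norm (Pi.single i (1 : ℤ) : Site d) = 1 := by
  rw [l1Norm, Finset.sum_eq_single i]
  · simp
  · intro j _ hj; simp [hj]
  · intro h; exact absurd (Finset.mem_univ i) h

/-- `J_{0,x} = C₀|x|₁^{-d-α}` for `x ≠ 0`. [cite: Panis2023Triviality, §1.2.1 (J_{x,y} = C|x-y|₁^{-d-α})] -/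
theorem algebraicCoupling_zero_apply {C₀ α : ℝ} {x : Site d} (hx : x ≠ 0) :
    algebraicCoupling d C₀ α 0 x = C₀ * (l1Norm x : ℝ) ^ (-((d : ℝ) + α)) := by
  rw [algebraicCoupling, if_neg (Ne.symm hx), zero_sub, l1Norm_neg_eq]

/-- `J_{0,eᵢ} = C₀`. [cite: Panis2023Triviality, §1.2.1 (J_{x,y} = C|x-y|₁^{-d-α})] -/
theorem algebraicCoupling_zero_single (C₀ α : ℝ) (i : Fin d) :
    algebraicCoupling d C₀ α 0 (Pi.single i 1) = C₀ := by
  have h : (Pi.single i (1 : ℤ) : Site d) ≠ 0 := by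
    intro h
    have := congr_fun h i
    simp at this
  rw [algebraicCoupling_zero_apply h, l1Norm_single_one]
  simp

/-- `J_{0,x} ≤ C₀ ‖x‖_∞^{-(d+α)}` (`|x|₁ ≥ |x|_∞`). [folklore] -/
theorem algebraicCoupling_zero_le_norm_rpow {C₀ α : ℝ} (hC₀ : 0 ≤ C₀) (hα : 0 ≤ α) (x : Site d) :
    algebraicCoupling d C₀ α 0 x ≤ C₀ * ‖x‖ ^ (-((d : ℝ) + α)) := by
  by_cases hx : x = 0
  · subst hx
    rw [algebraicCoupling, if_pos rfl, norm_zero]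
    exact mul_nonneg hC₀ (Real.rpow_nonneg le_rfl _)
  · rw [algebraicCoupling_zero_apply hx, Site.norm_eq_supNorm]
    refine mul_le_mul_of_nonneg_left ?_ hC₀
    have h1 : (0 : ℝ) < Site.supNorm x := by
      have : Site.supNorm x ≠ 0 := fun h => hx (Site.supNorm_eq_zero_iff.1 h)
      positivity
    exact Real.rpow_le_rpow_of_nonpos h1 (by exact_mod_cast supNorm_le_l1Norm_site x)
      (by linarith)

/-- `x ↦ J_{0,x}` is summable for the algebraically decaying coupling (`d ≥ 1`, `α > 0`). [cite: Panis2023Triviality, §1.2.1 ((A2))] -/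
theorem algebraicCoupling_zero_summable (hd : 1 ≤ d) {C₀ α : ℝ} (hC₀ : 0 ≤ C₀) (hα : 0 < α) :
    Summable fun x : Site d => algebraicCoupling d C₀ α 0 x :=
  Summable.of_nonneg_of_le (fun x => algebraicCoupling_nonneg hC₀ α 0 x)
    (fun x => algebraicCoupling_zero_le_norm_rpow hC₀ hα.le x)
    ((summable_site_norm_rpow_neg hd (by linarith)).mul_left C₀)

/-- `|J| ≥ C₀ > 0` for the algebraically decaying coupling (`d ≥ 1`: the term `x = e₀`). [folklore] -/
theorem couplingNorm_algebraic_pos (hd : 1 ≤ d) {C₀ α : ℝ} (hC₀ : 0 < C₀) (hα : 0 < α) :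
    0 < couplingNorm (algebraicCoupling d C₀ α) := by
  have h := (algebraicCoupling_zero_summable hd hC₀.le hα).le_tsum (Pi.single (⟨0, hd⟩ : Fin d) 1)
    (fun x _ => algebraicCoupling_nonneg hC₀.le α 0 x)
  rw [algebraicCoupling_zero_single] at h
  exact hC₀.trans_le h

end Algebraic

/-! ### `1 - Ĵ(p) = ∑_x (1 - cos(p·x)) J_{0,x}/|J| ≥ 0` and the nearest-neighbour lower bound -/

section Gap

variable (J : Site d → Site d → ℝ)

/-- **Remark 3.5**: `|J|(1 - Ĵ(p)) = ∑_x (1 - cos(p·x)) J_{0,x}` (`= 2∑_x sin²(p·x/2) J_{0,x}`), for a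
summable `J_{0,·}` with `|J| ≠ 0`. [cite: Panis2023Triviality, Remark 3.5] -/
theorem one_sub_couplingFourier_eq (hs : Summable fun x : Site d => J 0 x) (h0 : couplingNorm J ≠ 0)
    (p : Fin d → ℝ) :
    1 - couplingFourier J p = (∑' x : Site d, (1 - Real.cos (phase p x)) * J 0 x) / couplingNorm J := by
  have hs' : Summable fun x : Site d => Real.cos (phase p x) * J 0 x := by
    refine Summable.of_norm_bounded hs.norm fun x => ?_   -- |cos · J| ≤ |J|
    rw [norm_mul, Real.norm_eq_abs, Real.norm_eq_abs]
    exact mul_le_of_le_one_left (abs_nonneg _) (Real.abs_cos_le_one _)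
  rw [couplingFourier, eq_div_iff h0, sub_mul, div_mul_cancel₀ _ h0, one_mul, couplingNorm,
    ← hs.tsum_sub hs']
  exact tsum_congr fun x => by ring

/-- Finite partial sums bound `1 - Ĵ(p)` from below (`J_{0,·} ≥ 0` summable, `|J| > 0`):
`∑_{x∈s} (1 - cos(p·x)) J_{0,x} / |J| ≤ 1 - Ĵ(p)`. [cite: Panis2023Triviality, Remark 3.5] -/
theorem sum_le_one_sub_couplingFourier (hJ0 : ∀ x, 0 ≤ J 0 x) (hs : Summable fun x : Site d => J 0 x)
    (hpos : 0 < couplingNorm J) (p : Fin d → ℝ) (s : Finset (Site d)) :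
    (∑ x ∈ s, (1 - Real.cos (phase p x)) * J 0 x) / couplingNorm J ≤ 1 - couplingFourier J p := by
  rw [one_sub_couplingFourier_eq J hs hpos.ne' p]
  refine div_le_div_of_nonneg_right ?_ hpos.le
  have hnn : ∀ x, 0 ≤ (1 - Real.cos (phase p x)) * J 0 x := fun x =>
    mul_nonneg (sub_nonneg.2 (Real.cos_le_one _)) (hJ0 x)
  have hs2 : Summable fun x : Site d => (1 - Real.cos (phase p x)) * J 0 x := by
    refine Summable.of_nonneg_of_le hnn (fun x => ?_) (hs.mul_left 2)
    have := Real.neg_one_le_cos (phase p x)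
    nlinarith [hJ0 x]
  exact hs2.sum_le_tsum s fun x _ => hnn x

/-- `0 ≤ 1 - Ĵ(p)`, i.e. `Ĵ(p) ≤ 1` (`J_{0,·} ≥ 0` summable, `|J| > 0`). [cite: Panis2023Triviality, Remark 3.5] -/
theorem one_sub_couplingFourier_nonneg (hJ0 : ∀ x, 0 ≤ J 0 x) (hs : Summable fun x : Site d => J 0 x)
    (hpos : 0 < couplingNorm J) (p : Fin d → ℝ) : 0 ≤ 1 - couplingFourier J p := by
  simpa using sum_le_one_sub_couplingFourier J hJ0 hs hpos p ∅

/-- `Ĵ(0) = 1` (`|J| ≠ 0`). [cite: Panis2023Triviality, Proposition 3.4 (definition of Ĵ)] -/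
theorem couplingFourier_zero (h0 : couplingNorm J ≠ 0) : couplingFourier J 0 = 1 := by
  have h : (fun x : Site d => Real.cos (phase 0 x) * J 0 x) = fun x => J 0 x := by
    funext x; simp [phase]
  rw [couplingFourier, h, ← couplingNorm, div_self h0]

/-- Jordan's inequality in the form `2t²/π² ≤ 1 - cos t` for `|t| ≤ π`. [folklore] -/
theorem two_mul_sq_div_le_one_sub_cos {t : ℝ} (ht : |t| ≤ Real.pi) :
    2 * t ^ 2 / Real.pi ^ 2 ≤ 1 - Real.cos t := by
  have hπ := Real.pi_pos
  -- `1 - cos t = 2 sin²(t/2)` and `|sin(t/2)| ≥ |t|/π`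
  have h1 : 1 - Real.cos t = 2 * Real.sin (t / 2) ^ 2 := by
    rw [Real.sin_sq_eq_half_sub, mul_div_cancel₀ t two_ne_zero]; ring
  have h3 : |t| / Real.pi ≤ |Real.sin (t / 2)| := by
    have hu0 : 0 ≤ |t| / 2 := by positivity
    have hu1 : |t| / 2 ≤ Real.pi / 2 := by linarith
    have h4 := Real.mul_le_sin hu0 hu1
    have h5 : Real.sin (|t| / 2) = |Real.sin (t / 2)| := by
      rcases abs_choice t with h | h
      · rw [h, abs_of_nonneg]
        rw [h] at hu1
        exact Real.sin_nonneg_of_nonneg_of_le_pi (by linarith [abs_nonneg t, h]) (by linarith)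
      · rw [h, neg_div, Real.sin_neg, abs_of_nonpos]
        have : t / 2 ≤ 0 := by linarith [abs_nonneg t]
        exact Real.sin_nonpos_of_nonpos_of_neg_pi_le this (by linarith [abs_nonneg t])
    rw [← h5]
    calc |t| / Real.pi = 2 / Real.pi * (|t| / 2) := by ring
      _ ≤ Real.sin (|t| / 2) := h4
  have h6 : (|t| / Real.pi) ^ 2 ≤ Real.sin (t / 2) ^ 2 := by
    rw [← sq_abs (Real.sin _)]
    exact pow_le_pow_left₀ (by positivity) h3 2
  rw [h1]
  calc 2 * t ^ 2 / Real.pi ^ 2 = 2 * (|t| / Real.pi) ^ 2 := by rw [div_pow, sq_abs]; ring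
    _ ≤ 2 * Real.sin (t / 2) ^ 2 := by linarith

/-- The sup norm of `p ∈ ℝ^d` is controlled by the Euclidean sum of squares: `‖p‖² ≤ ∑ᵢ pᵢ²` (also
proved as `Literature.Barriers.CriticalPhenomena.norm_sq_le_sum_sq` in `LaceExpansionKernelFourier.lean`,
not imported here for the same reason). [folklore] -/
private theorem norm_sq_le_sum_sq (p : Fin d → ℝ) : ‖p‖ ^ 2 ≤ ∑ i, p i ^ 2 := by
  have h : ‖p‖ ≤ Real.sqrt (∑ i, p i ^ 2) := by
    refine (pi_norm_le_iff_of_nonneg (Real.sqrt_nonneg _)).2 fun i => ?_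
    rw [Real.norm_eq_abs, ← Real.sqrt_sq_eq_abs]
    exact Real.sqrt_le_sqrt (Finset.single_le_sum (f := fun j => p j ^ 2) (fun j _ => sq_nonneg _)
      (Finset.mem_univ i))
  calc ‖p‖ ^ 2 ≤ Real.sqrt (∑ i, p i ^ 2) ^ 2 := pow_le_pow_left₀ (norm_nonneg _) h 2
    _ = ∑ i, p i ^ 2 := Real.sq_sqrt (Finset.sum_nonneg fun i _ => sq_nonneg _)

/-- **Nearest-neighbour lower bound on `1 - Ĵ` for the algebraically decaying coupling**: on the
cube `‖q‖_∞ ≤ π`, `1 - Ĵ(q) ≥ (2C₀/(π²|J|)) ‖q‖_∞²` (keep the `2d` terms `x = ±eᵢ`, `J_{0,±eᵢ} = C₀`,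
and `1 - cos qᵢ ≥ 2qᵢ²/π²`). [cite: Panis2023Triviality, §3.3 ("1 - Ĵ(k) ≳ ‖k‖₂² as k → 0")] -/
theorem sq_le_one_sub_couplingFourier_algebraic (hd : 1 ≤ d) {C₀ α : ℝ} (hC₀ : 0 < C₀) (hα : 0 < α) :
    ∃ c₁ : ℝ, 0 < c₁ ∧ ∀ q : Fin d → ℝ, ‖q‖ ≤ Real.pi →
      c₁ * ‖q‖ ^ 2 ≤ 1 - couplingFourier (algebraicCoupling d C₀ α) q := by
  set J := algebraicCoupling d C₀ α with hJdef
  have hpos := couplingNorm_algebraic_pos hd hC₀ hα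
  have hs := algebraicCoupling_zero_summable hd hC₀.le hα
  have hJ0 : ∀ x, 0 ≤ J 0 x := fun x => algebraicCoupling_nonneg hC₀.le α 0 x
  refine ⟨2 * C₀ / (Real.pi ^ 2 * couplingNorm J), by positivity, fun q hq => ?_⟩
  -- the axis points `eᵢ`
  set s : Finset (Site d) := Finset.univ.image fun i : Fin d => (Pi.single i (1 : ℤ) : Site d) with hsdef
  have hinj : Function.Injective fun i : Fin d => (Pi.single i (1 : ℤ) : Site d) := by
    intro i j h
    by_contra hij
    have h' := congr_fun h i
    simp [hij] at h'
  have hsum : ∑ x ∈ s, (1 - Real.cos (phase q x)) * J 0 x = ∑ i : Fin d, (1 - Real.cos (q i)) * C₀ := by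
    rw [hsdef, Finset.sum_image fun i _ j _ h => hinj h]
    refine Finset.sum_congr rfl fun i _ => ?_
    rw [hJdef, algebraicCoupling_zero_single]
    congr 2
    rw [phase, Finset.sum_eq_single i]
    · simp
    · intro j _ hj; simp [hj]
    · intro h; exact absurd (Finset.mem_univ i) h
  have hle := sum_le_one_sub_couplingFourier J hJ0 hs hpos q s
  rw [hsum] at hle
  refine le_trans ?_ hle
  have hqi : ∀ i, |q i| ≤ Real.pi := fun i => (norm_le_pi_norm q i).trans hq
  have hterm : ∀ i, 2 * (q i) ^ 2 / Real.pi ^ 2 * C₀ ≤ (1 - Real.cos (q i)) * C₀ := fun i =>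
    mul_le_mul_of_nonneg_right (two_mul_sq_div_le_one_sub_cos (hqi i)) hC₀.le
  calc 2 * C₀ / (Real.pi ^ 2 * couplingNorm J) * ‖q‖ ^ 2
      ≤ 2 * C₀ / (Real.pi ^ 2 * couplingNorm J) * ∑ i, q i ^ 2 :=
        mul_le_mul_of_nonneg_left (norm_sq_le_sum_sq q) (by positivity)
    _ = (∑ i, 2 * (q i) ^ 2 / Real.pi ^ 2 * C₀) / couplingNorm J := by
        rw [Finset.sum_div, Finset.mul_sum]
        refine Finset.sum_congr rfl fun i _ => ?_
        field_simp
    _ ≤ (∑ i, (1 - Real.cos (q i)) * C₀) / couplingNorm J :=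
        div_le_div_of_nonneg_right (Finset.sum_le_sum fun i _ => hterm i) hpos.le

/-- `p ↦ p·x` is continuous. [folklore] -/
theorem continuous_phase (x : Site d) : Continuous fun p : Fin d → ℝ => phase p x :=
  continuous_finsetSum _ fun i _ => (continuous_apply i).mul continuous_const

/-- **`Ĵ` is continuous** for a summable `J_{0,·} ≥ 0` (uniformly convergent trigonometric series). [folklore] -/
theorem continuous_couplingFourier (hJ0 : ∀ x, 0 ≤ J 0 x) (hs : Summable fun x : Site d => J 0 x) :
    Continuous (couplingFourier J) := by
  unfold couplingFourier
  refine Continuous.div_const (continuous_tsum (fun x => ?_) hs fun x p => ?_) _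
  · exact (Real.continuous_cos.comp (continuous_phase x)).mul continuous_const
  · rw [norm_mul, Real.norm_eq_abs, Real.norm_eq_abs, abs_of_nonneg (hJ0 x)]
    exact mul_le_of_le_one_left (hJ0 x) (Real.abs_cos_le_one _)

end Gap

/-! ### The product kernel `W(p) = ∏ᵢ (1 ∨ pᵢ²)⁻¹ ≥ e^{-‖p‖₂²}` and `∫ W(p)‖p‖^{-a} dp < ∞` (`a < d`) -/

section Kernel

/-- `W(p) := ∏ᵢ (max(1, pᵢ²))⁻¹`, an upper envelope of the Gaussian `e^{-‖p‖₂²}` and of the normalised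
Fejér kernels. [folklore] -/
def envelope (d : ℕ) (p : Fin d → ℝ) : ℝ := ∏ i, (max 1 (p i ^ 2))⁻¹

/-- `W ≥ 0`. [folklore] -/
theorem envelope_nonneg (p : Fin d → ℝ) : 0 ≤ envelope d p :=
  Finset.prod_nonneg fun _ _ => inv_nonneg.2 (le_max_of_le_left zero_le_one)

/-- `W ≤ 1`. [folklore] -/
theorem envelope_le_one (p : Fin d → ℝ) : envelope d p ≤ 1 :=
  Finset.prod_le_one (fun _ _ => inv_nonneg.2 (le_max_of_le_left zero_le_one)) fun _ _ =>
    inv_le_one_of_one_le₀ (le_max_left _ _)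

/-- `e^{-t²} ≤ (1 ∨ t²)⁻¹`. [folklore] -/
theorem exp_neg_sq_le (t : ℝ) : Real.exp (-t ^ 2) ≤ (max 1 (t ^ 2))⁻¹ := by
  rw [le_inv_comm₀ (Real.exp_pos _) (by positivity), ← Real.exp_neg, neg_neg, max_le_iff]
  exact ⟨Real.one_le_exp (sq_nonneg t), by linarith [Real.add_one_le_exp (t ^ 2)]⟩

/-- `e^{-‖p‖₂²} ≤ W(p)`. [folklore] -/
theorem exp_neg_sum_sq_le_envelope (p : Fin d → ℝ) : Real.exp (-∑ i, p i ^ 2) ≤ envelope d p := by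
  rw [← Finset.sum_neg_distrib, Real.exp_sum, envelope]
  exact Finset.prod_le_prod (fun i _ => (Real.exp_pos _).le) fun i _ => exp_neg_sq_le (p i)

/-- `W` is continuous. [folklore] -/
theorem continuous_envelope : Continuous (envelope d) := by
  unfold envelope
  refine continuous_finsetProd _ fun i _ => ?_
  exact (continuous_const.max ((continuous_apply i).pow 2)).inv₀ fun p =>
    (lt_of_lt_of_le one_pos (le_max_left _ _)).ne'

/-- `(1 ∨ t²)⁻¹ ≤ 2(1 + t²)⁻¹`, so `W` is integrable on `ℝ^d`. [folklore] -/
theorem integrable_envelope : Integrable (envelope d) := by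
  have h1 : Integrable fun t : ℝ => (max 1 (t ^ 2))⁻¹ := by
    refine Integrable.mono' (integrable_inv_one_add_sq.const_mul 2) ?_ (ae_of_all _ fun t => ?_)
    · exact ((continuous_const.max (continuous_id.pow 2)).inv₀ fun t =>
        (lt_of_lt_of_le one_pos (le_max_left _ _)).ne').aestronglyMeasurable
    · have hm : 0 < max 1 (t ^ 2) := lt_of_lt_of_le one_pos (le_max_left _ _)
      rw [Real.norm_eq_abs, abs_of_nonneg (inv_nonneg.2 hm.le), ← div_eq_mul_inv,
        inv_le_comm₀ hm (by positivity), inv_div]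
      rcases le_total 1 (t ^ 2) with h | h
      · rw [max_eq_right h]; linarith
      · rw [max_eq_left h]; linarith
  exact Integrable.fintype_prod (f := fun (_ : Fin d) (t : ℝ) => (max 1 (t ^ 2))⁻¹) fun _ => h1

/-- The kernel `p ↦ W(p) ‖p‖_∞^{-a}`. [folklore] -/
def envelopeRiesz (d : ℕ) (a : ℝ) (p : Fin d → ℝ) : ℝ := envelope d p * ‖p‖ ^ (-a)

/-- `W(p)‖p‖^{-a} ≥ 0`. [folklore] -/
theorem envelopeRiesz_nonneg (a : ℝ) (p : Fin d → ℝ) : 0 ≤ envelopeRiesz d a p :=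
  mul_nonneg (envelope_nonneg p) (Real.rpow_nonneg (norm_nonneg _) _)

/-- `W(p)‖p‖^{-a}` is measurable. [folklore] -/
theorem measurable_envelopeRiesz (a : ℝ) : Measurable (envelopeRiesz d a) :=
  continuous_envelope.measurable.mul (measurable_norm.pow_const _)

/-- **`∫_{ℝ^d} W(p)‖p‖_∞^{-a} dp < ∞` for `0 ≤ a < d`** (local integrability of `‖p‖^{-a}` near the
origin, `W ≤ 1`; and `‖p‖^{-a} ≤ 1`, `W ∈ L¹` away from it). [folklore] -/
theorem integrable_envelopeRiesz (hd : 1 ≤ d) {a : ℝ} (ha0 : 0 ≤ a) (ha : a < d) :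
    Integrable (envelopeRiesz d a) := by
  have hmeas := (measurable_envelopeRiesz (d := d) a).aestronglyMeasurable (μ := volume)
  have h1 : IntegrableOn (envelopeRiesz d a) (Metric.ball 0 1) := by
    refine integrableOn_ball_of_norm_le_rpow (μ := volume) (C := 1) (α := a) (r := 1) ?_ ?_ ?_ hmeas
    · rw [Module.finrank_fin_fun]; exact hd
    · rw [Module.finrank_fin_fun]; exact ha
    · refine ae_of_all _ fun p => ?_
      rw [Real.norm_eq_abs, abs_of_nonneg (envelopeRiesz_nonneg a p), envelopeRiesz, one_mul]
      exact mul_le_of_le_one_left (Real.rpow_nonneg (norm_nonneg _) _) (envelope_le_one p)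
  have h2 : IntegrableOn (envelopeRiesz d a) (Metric.ball 0 1)ᶜ := by
    refine Integrable.mono' (integrable_envelope (d := d)).integrableOn hmeas.restrict ?_
    refine (ae_restrict_iff' (measurableSet_ball).compl).2 (ae_of_all _ fun p hp => ?_)
    rw [Set.mem_compl_iff, Metric.mem_ball, dist_zero_right, not_lt] at hp
    rw [Real.norm_eq_abs, abs_of_nonneg (envelopeRiesz_nonneg a p), envelopeRiesz]
    exact mul_le_of_le_one_right (envelope_nonneg p) (Real.rpow_le_one_of_one_le_of_nonpos hp (by linarith))
  have := h1.union h2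
  rwa [Set.union_compl_self, integrableOn_univ] at this

end Kernel

/-! ### From a small-momentum lower bound on `1 - Ĵ` to a bound on the whole cube `[-π,π]^d` -/

section Global

/-- A lower bound `1 - Ĵ(p) ≥ c‖p‖^a` for `‖p‖ < r` (`a ≤ 2`) extends to the cube `‖q‖_∞ ≤ π` with a
smaller constant, by the nearest-neighbour bound `1 - Ĵ(q) ≥ c₁‖q‖²` (`‖q‖² ≥ r^{2-a}‖q‖^a` for
`‖q‖ ≥ r`). [folklore] -/
theorem rpow_le_one_sub_couplingFourier_of_lower (hd : 1 ≤ d) {C₀ α : ℝ} (hC₀ : 0 < C₀) (hα : 0 < α)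
    {a c r : ℝ} (ha2 : a ≤ 2) (hc : 0 < c) (hr : 0 < r)
    (hlow : ∀ p : Fin d → ℝ, ‖p‖ < r → c * ‖p‖ ^ a ≤ 1 - couplingFourier (algebraicCoupling d C₀ α) p) :
    ∃ c' : ℝ, 0 < c' ∧ ∀ q : Fin d → ℝ, ‖q‖ ≤ Real.pi →
      c' * ‖q‖ ^ a ≤ 1 - couplingFourier (algebraicCoupling d C₀ α) q := by
  obtain ⟨c₁, hc₁, hnn⟩ := sq_le_one_sub_couplingFourier_algebraic hd hC₀ hα
  refine ⟨min c (c₁ * r ^ (2 - a)), lt_min hc (by positivity), fun q hq => ?_⟩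
  have hqa : 0 ≤ ‖q‖ ^ a := Real.rpow_nonneg (norm_nonneg _) _
  by_cases hqr : ‖q‖ < r
  · exact (mul_le_mul_of_nonneg_right (min_le_left _ _) hqa).trans (hlow q hqr)
  · rw [not_lt] at hqr
    have hq0 : 0 < ‖q‖ := hr.trans_le hqr
    calc min c (c₁ * r ^ (2 - a)) * ‖q‖ ^ a ≤ c₁ * r ^ (2 - a) * ‖q‖ ^ a :=
          mul_le_mul_of_nonneg_right (min_le_right _ _) hqa
      _ ≤ c₁ * ‖q‖ ^ (2 - a) * ‖q‖ ^ a := by gcongr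
      _ = c₁ * ‖q‖ ^ 2 := by
          rw [mul_assoc, ← Real.rpow_add hq0, ← Real.rpow_two]
          norm_num
      _ ≤ 1 - couplingFourier (algebraicCoupling d C₀ α) q := hnn q hq

end Global

end LongRangeIsing

open LongRangeIsing

/-! ### The printed input (named fact): Proposition 3.8's first display, kernel form -/

/-- The box of momenta `(-π n, π n]^d ⊂ ℝ^d`. [cite: Panis2023Triviality, Proposition 3.8 (domain of integration (-π|x|,π|x|]^d)] -/
def LongRangeIsing.momentumBox (d : ℕ) (n : ℝ) : Set (Fin d → ℝ) :=
  Set.pi Set.univ fun _ : Fin d => Set.Ioc (-(Real.pi * n)) (Real.pi * n)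

/-- NAMED FACT (kernel form of Proposition 3.8's first display) — **Panis 2023, Proposition 3.8, first
display (the `x`-space infrared bound through `Ĵ`), for `J_{x,y} = C₀|x-y|₁^{-d-α}`, with the Gaussian
`e^{-‖p‖₂²}` replaced by the larger product kernel `W(p) = ∏ᵢ(1 ∨ pᵢ²)⁻¹`.** Printed: "Let `d ≥ 3`. There
exists `C = C(d) > 0` such that for every `β ≤ β_c(ρ)`, and every `x ∈ ℤ^d ∖ {0}`,
`S_{ρ,β}(x) ≤ C/(β|J||x|^d) ∫_{(-π|x|,π|x|]^d} e^{-‖p‖₂²}/(1 - Ĵ(p/|x|)) dp`" (the held TeX-derived text prints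
the argument of `Ĵ` as `|p|/|x|`; the proof's `1 - Ĵ(u/L)` shows it is the vector `p/|x|`). Vendored:
`S_β(x) ≤ C/(β|x|^d) ∫_{(-π|x|,π|x|]^d} W(p)/(1 - Ĵ(p/|x|)) dp` for `d ≥ 3`, `0 < β ≤ β_c`, `x ≠ 0`, for the
algebraically decaying family (reflection positive, (A1)–(A5): §3.1 example (iii)), `|x| = ‖x‖_∞`, the
natural power `‖x‖^d`, `|J|` absorbed into `C` (it may depend on `d, C₀, α`), the Lebesgue integral over
the box in `ℝ^d = (Fin d → ℝ)`, `Ĵ` in the real form `couplingFourier`. Formally WEAKER than the printed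
display (`e^{-‖p‖₂²} ≤ W(p)`, `exp_neg_sum_sq_le_envelope`; the enlarged integrand stays integrable because
`1 - Ĵ(q) ≥ c₁‖q‖²` on the cube and `2 < d`), and the form that a proof of Proposition 3.8 with the Fejér
kernel `|D_L(p)|²/|Λ_L|` in place of the Gaussian weight yields directly (`|D_L(u/L)|² ≲ L²(1 ∨ u²)⁻¹` per
coordinate). DISCHARGED: `panis_prop38_kernelForm_holds` (`LongRangeTrivialityOnZ3InfraredBoundKernel.lean`).
Users take `(h : panis_prop38_kernelForm)` or that theorem.
[cite: Panis2023Triviality, Proposition 3.8 (first display), weakened by e^{-‖p‖₂²} ≤ ∏(1∨pᵢ²)⁻¹] -/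
def panis_prop38_kernelForm : Prop :=
  ∀ (d : ℕ), 3 ≤ d → ∀ (C₀ α : ℝ), 0 < C₀ → 0 < α →
    ∃ C : ℝ, 0 < C ∧ ∀ (β : ℝ), 0 < β → β ≤ LongRangeIsing.criticalBeta (algebraicCoupling d C₀ α) →
      ∀ (x : Site d), x ≠ 0 →
        pairCorrelation (algebraicCoupling d C₀ α) β 0 x ≤
          C / (β * ‖x‖ ^ d) *
            ∫ p in momentumBox d ‖x‖, envelope d p /
              (1 - couplingFourier (algebraicCoupling d C₀ α) (fun i => p i / ‖x‖))

/-- NAMED FACT (discharged below) — **the small-momentum behaviour of `1 - Ĵ` for power-law couplings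
(Panis 2023, §3.3, display before Remark 3.9: "Power law decay interactions: as `p → 0`,
`1 - Ĵ(p) ≍ |p|²` (`α > 2`), `|p|² log(1/|p|)` (`α = 2`), `|p|^α` (`α ∈ (0,2)`)").** Vendored: ONLY the
lower-bound half of `≍`, near `p = 0`, for `α ≠ 2` and `J_{x,y} = C₀|x-y|₁^{-d-α}` (`d ≥ 1`), with the
sup norm of `p ∈ ℝ^d` (immaterial up to the constant): there are `c, r > 0` with
`c‖p‖^{α∧2} ≤ 1 - Ĵ(p)` whenever `‖p‖ < r`. PROVED: `panis_couplingFourierGap_lower_holds`. Users take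
`(h : panis_couplingFourierGap_lower)` or the theorem.
[cite: Panis2023Triviality, §3.3, display "1 - Ĵ(p) ≍ …" for power law decay interactions (before Remark 3.9)] -/
def panis_couplingFourierGap_lower : Prop :=
  ∀ (d : ℕ), 1 ≤ d → ∀ (C₀ α : ℝ), 0 < C₀ → 0 < α → α ≠ 2 →
    ∃ c r : ℝ, 0 < c ∧ 0 < r ∧ ∀ p : Fin d → ℝ, ‖p‖ < r →
      c * ‖p‖ ^ min α 2 ≤ 1 - couplingFourier (algebraicCoupling d C₀ α) p

/-- NAMED FACT (proved below from `panis_prop38_kernelForm`) — **the infrared bound for algebraically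
decaying couplings with the factor `1/β` (Panis 2023, §3.3, display before Remark 3.9).** "Together with
Corollary [= Proposition 3.8], we get that for algebraic decay interactions,
`⟨τ₀τ_x⟩_{ρ,β} ≤ C/(β|J|) · |x|^{-(d-2)}` (`α > 2`), `|x|^{-(d-2)}(log|x|)^{-1}` (`α = 2`), `|x|^{-(d-α)}`
(`α ∈ (0,2)`)" — for the `β` and `d` of Proposition 3.8 (`β ≤ β_c(ρ)`, `d ≥ 3`; Remark 3.9 discusses
`d ≤ 2`). Vendored for `α ≠ 2`, `d ≥ 3`, `0 < β ≤ β_c`, `x ≠ 0`, `|x| = ‖x‖_∞`, `|J|` absorbed. It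
implies the `§3.6` form `panis_infraredBound_algebraic` by monotonicity in `β`
(`panis_infraredBound_algebraic_of_beta`). Users take `(h : panis_infraredBound_algebraic_beta)`.
[cite: Panis2023Triviality, §3.3, display "for algebraic decay interactions" (before Remark 3.9)] -/
def panis_infraredBound_algebraic_beta : Prop :=
  ∀ (d : ℕ), 3 ≤ d → ∀ (C₀ α : ℝ), 0 < C₀ → 0 < α → α ≠ 2 →
    ∃ C : ℝ, 0 < C ∧ ∀ (β : ℝ), 0 < β → β ≤ LongRangeIsing.criticalBeta (algebraicCoupling d C₀ α) →
      ∀ (x : Site d), x ≠ 0 →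
        pairCorrelation (algebraicCoupling d C₀ α) β 0 x ≤ C / (β * ‖x‖ ^ ((d : ℝ) - min α 2))

/-! ### Discharge of `panis_couplingFourierGap_lower` (a lattice-point count) -/

namespace LongRangeIsing

variable {d : ℕ}

/-- For `π ≤ |η| ≤ π + 1` and every `θ`, `(1 - cos θ) + (1 - cos(θ + η)) ≥ 1`
(`cos θ + cos(θ+η) = 2cos(θ+η/2)cos(η/2)` and `|cos(η/2)| = sin(|η|/2 - π/2) ≤ 1/2`). [folklore] -/
theorem one_le_two_sub_cos_sub_cos (θ : ℝ) {η : ℝ} (h1 : Real.pi ≤ |η|) (h2 : |η| ≤ Real.pi + 1) :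
    1 ≤ (1 - Real.cos θ) + (1 - Real.cos (θ + η)) := by
  have hc : |Real.cos (η / 2)| ≤ 1 / 2 := by
    set u : ℝ := |η| / 2 - Real.pi / 2 with hu
    have hu0 : 0 ≤ u := by rw [hu]; linarith
    have hu1 : u ≤ 1 / 2 := by rw [hu]; linarith
    have h3 : Real.cos (η / 2) = -Real.sin u := by
      rw [← Real.cos_abs, abs_div, abs_two, show |η| / 2 = u + Real.pi / 2 by rw [hu]; ring,
        Real.cos_add_pi_div_two]
    rw [h3, abs_neg, abs_of_nonneg (Real.sin_nonneg_of_nonneg_of_le_pi hu0 (by linarith [Real.two_le_pi]))]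
    exact (Real.sin_le hu0).trans hu1
  have hsum : Real.cos θ + Real.cos (θ + η) = 2 * Real.cos (θ + η / 2) * Real.cos (η / 2) := by
    rw [Real.cos_add_cos]
    have e1 : (θ + (θ + η)) / 2 = θ + η / 2 := by ring
    have e2 : (θ - (θ + η)) / 2 = -(η / 2) := by ring
    rw [e1, e2, Real.cos_neg]
  have h4 : Real.cos θ + Real.cos (θ + η) ≤ 1 := by
    rw [hsum]
    have hb : |2 * Real.cos (θ + η / 2) * Real.cos (η / 2)| ≤ 1 := by
      rw [abs_mul, abs_mul, abs_two]
      calc 2 * |Real.cos (θ + η / 2)| * |Real.cos (η / 2)| ≤ 2 * 1 * (1 / 2) := by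
            gcongr
            exact Real.abs_cos_le_one _
        _ = 1 := by norm_num
    exact (le_abs_self _).trans hb
  linarith

/-- The phase is additive in the site. [folklore] -/
theorem phase_add (p : Fin d → ℝ) (x y : Site d) : phase p (x + y) = phase p x + phase p y := by
  simp only [phase, Pi.add_apply, Int.cast_add, mul_add, Finset.sum_add_distrib]

/-- `p·(K eⱼ) = K pⱼ`. [folklore] -/
theorem phase_single (p : Fin d → ℝ) (j : Fin d) (K : ℤ) : phase p (Pi.single j K) = (K : ℝ) * p j := by
  rw [phase, Finset.sum_eq_single j]
  · simp [mul_comm]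
  · intro i _ hi; simp [hi]
  · intro h; exact absurd (Finset.mem_univ j) h

/-- The sup norm of `p ∈ ℝ^d` (`d ≥ 1`) is attained at a coordinate. [folklore] -/
theorem exists_abs_eq_norm (hd : 1 ≤ d) (p : Fin d → ℝ) : ∃ j : Fin d, |p j| = ‖p‖ := by
  have hne : (Finset.univ : Finset (Fin d)).Nonempty := ⟨⟨0, hd⟩, Finset.mem_univ _⟩
  obtain ⟨j, -, hj⟩ := Finset.exists_max_image Finset.univ (fun i => |p i|) hne
  refine ⟨j, le_antisymm ?_ ?_⟩
  · simpa [Real.norm_eq_abs] using norm_le_pi_norm p j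
  · exact (pi_norm_le_iff_of_nonneg (abs_nonneg _)).2 fun i => by
      simpa [Real.norm_eq_abs] using hj i (Finset.mem_univ i)

/-- The `ℓ¹` norm of a site whose coordinates are bounded: `|xᵢ| ≤ bᵢ ⇒ |x|₁ ≤ ∑ bᵢ`. [folklore] -/
theorem l1Norm_le_of_forall_le (x : Site d) (b : Fin d → ℕ) (h : ∀ i, (x i).natAbs ≤ b i) :
    l1Norm x ≤ ∑ i, b i :=
  Finset.sum_le_sum fun i _ => h i

end LongRangeIsing

/-- **Discharge of `panis_couplingFourierGap_lower`.** For `α > 2` this is the nearest-neighbour bound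
`1 - Ĵ(p) ≥ c₁‖p‖²` on the cube. For `α < 2`: let `s = ‖p‖_∞ = |p_j| ∈ (0,1)` and `k = ⌈π/s⌉`, so
`ks ∈ [π, π+1]`; on the `k(2k+1)^{d-1} ≥ k^d` sites `x` with `1 ≤ x_j ≤ k`, `|x_i| ≤ k` (`i ≠ j`), pair
`x` with `x + ke_j`: `(1 - cos(p·x)) + (1 - cos(p·x + kp_j)) ≥ 1` and both couplings are
`≥ C₀((d+1)k)^{-d-α}`, whence `|J|(1 - Ĵ(p)) ≥ C₀(d+1)^{-d-α}k^{-α} ≥ C₀(d+1)^{-d-α}(π+1)^{-α}s^α`.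
[cite: Panis2023Triviality, §3.3, display "1 - Ĵ(p) ≍ …" for power law decay interactions (before Remark 3.9)] -/
theorem panis_couplingFourierGap_lower_holds : panis_couplingFourierGap_lower := by
  intro d hd C₀ α hC₀ hα hα2
  set J := algebraicCoupling d C₀ α with hJdef
  have hpos := couplingNorm_algebraic_pos hd hC₀ hα
  have hs := algebraicCoupling_zero_summable hd hC₀.le hα
  have hJ0 : ∀ y, 0 ≤ J 0 y := fun y => algebraicCoupling_nonneg hC₀.le α 0 y
  rcases lt_or_gt_of_ne hα2 with hlt | hgt
  swap
  · -- `α > 2`: `α ∧ 2 = 2`, nearest neighbours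
    rw [min_eq_right hgt.le]
    obtain ⟨c₁, hc₁, hnn⟩ := sq_le_one_sub_couplingFourier_algebraic hd hC₀ hα
    refine ⟨c₁, Real.pi, hc₁, Real.pi_pos, fun p hp => ?_⟩
    rw [Real.rpow_two]
    exact hnn p hp.le
  -- `α < 2`: `α ∧ 2 = α`, the lattice-point count
  rw [min_eq_left hlt.le]
  set c : ℝ := C₀ * ((d : ℝ) + 1) ^ (-((d : ℝ) + α)) * (Real.pi + 1) ^ (-α) / couplingNorm J with hcdef
  refine ⟨c, 1, by positivity, one_pos, fun p hp1 => ?_⟩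
  by_cases hp0 : p = 0
  · subst hp0
    rw [norm_zero, Real.zero_rpow hα.ne', mul_zero]
    exact one_sub_couplingFourier_nonneg J hJ0 hs hpos _
  -- the scale
  set s : ℝ := ‖p‖ with hsdef
  have hs0 : 0 < s := norm_pos_iff.2 hp0
  obtain ⟨j, hj⟩ := exists_abs_eq_norm hd p
  set k : ℕ := ⌈Real.pi / s⌉₊ with hkdef
  have hk1 : Real.pi ≤ k * s := by
    have := Nat.le_ceil (Real.pi / s)
    rw [← hkdef] at this
    rwa [div_le_iff₀ hs0] at this
  have hk2 : (k : ℝ) * s ≤ Real.pi + 1 := by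
    have h := (Nat.ceil_lt_add_one (by positivity : 0 ≤ Real.pi / s)).le
    rw [← hkdef] at h
    have h' : (k : ℝ) * s ≤ (Real.pi / s + 1) * s := mul_le_mul_of_nonneg_right h hs0.le
    rw [add_mul, div_mul_cancel₀ _ hs0.ne', one_mul] at h'
    linarith [hp1]
  have hk0 : (0 : ℝ) < k := by
    have : 0 < k := Nat.ceil_pos.2 (by positivity)
    exact_mod_cast this
  have hkle : (k : ℝ) ≤ (Real.pi + 1) / s := by
    rw [le_div_iff₀ hs0]; exact hk2
  -- the sites `X = [1,k] × [-k,k]^{d-1}` (coordinate `j` first) and the shift `v = k e_j`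
  set K : ℤ := (k : ℤ) with hKdef
  set X : Finset (Site d) :=
    Fintype.piFinset fun i => if i = j then Finset.Icc (1 : ℤ) K else Finset.Icc (-K) K with hXdef
  set v : Site d := Pi.single j K with hvdef
  have hmemX : ∀ x ∈ X, (1 ≤ x j ∧ x j ≤ K) ∧ ∀ i, -K ≤ x i ∧ x i ≤ K := by
    intro x hx
    rw [hXdef, Fintype.mem_piFinset] at hx
    have hxj := hx j
    rw [if_pos rfl, Finset.mem_Icc] at hxj
    refine ⟨hxj, fun i => ?_⟩
    have hxi := hx i
    by_cases hij : i = j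
    · subst hij; constructor <;> omega
    · rw [if_neg hij, Finset.mem_Icc] at hxi; exact hxi
  have hinj : Function.Injective fun x : Site d => x + v := add_left_injective v
  have hdisj : Disjoint X (X.image fun x => x + v) := by
    rw [Finset.disjoint_left]
    intro x hx hx'
    obtain ⟨y, hy, hyx⟩ := Finset.mem_image.1 hx'
    have h1 := (hmemX _ hx).1.2
    have h2 := (hmemX y hy).1.1
    have h3 : x j = y j + K := by rw [← hyx]; simp [hvdef]
    have hK1 : (1 : ℤ) ≤ K := by rw [hKdef]; exact_mod_cast Nat.ceil_pos.2 (by positivity)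
    omega
  -- the coupling lower bound `m = C₀((d+1)k)^{-d-α}` on `X ∪ (X + v)`
  set m : ℝ := C₀ * (((d : ℝ) + 1) * k) ^ (-((d : ℝ) + α)) with hmdef
  have hm0 : 0 ≤ m := by positivity
  have hJge : ∀ x : Site d, x ≠ 0 → l1Norm x ≤ (d + 1) * k → m ≤ J 0 x := by
    intro x hx hxl
    rw [hJdef, algebraicCoupling_zero_apply hx, hmdef]
    refine mul_le_mul_of_nonneg_left ?_ hC₀.le
    have hl0 : (0 : ℝ) < l1Norm x := by
      have : l1Norm x ≠ 0 := fun h => hx (Site.supNorm_eq_zero_iff.1 (Nat.eq_zero_of_le_zero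
        ((supNorm_le_l1Norm_site x).trans h.le)))
      positivity
    refine Real.rpow_le_rpow_of_nonpos hl0 ?_ (by linarith)
    exact_mod_cast hxl
  set b : Fin d → ℕ := fun i => k + if i = j then k else 0 with hbdef
  have hbsum : ∑ i, b i = (d + 1) * k := by
    simp only [hbdef, Finset.sum_add_distrib, Finset.sum_const, Finset.card_univ, Fintype.card_fin,
      smul_eq_mul, Finset.sum_ite_eq', Finset.mem_univ, if_true]
    ring
  have hb : ∀ x ∈ X, (x ≠ 0 ∧ l1Norm x ≤ (d + 1) * k) ∧ (x + v ≠ 0 ∧ l1Norm (x + v) ≤ (d + 1) * k) := by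
    intro x hx
    obtain ⟨hxj, hxi⟩ := hmemX x hx
    refine ⟨⟨fun h => ?_, ?_⟩, ⟨fun h => ?_, ?_⟩⟩
    · have := congr_fun h j; simp at this; omega
    · rw [← hbsum]
      refine l1Norm_le_of_forall_le x b fun i => ?_
      have := hxi i
      simp only [hbdef]
      split_ifs <;> omega
    · have := congr_fun h j
      simp only [hvdef, Pi.add_apply, Pi.single_eq_same, Pi.zero_apply] at this
      omega
    · rw [← hbsum]
      refine l1Norm_le_of_forall_le (x + v) b fun i => ?_
      have := hxi i
      by_cases hij : i = j
      · subst hij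
        simp only [hbdef, hvdef, Pi.add_apply, Pi.single_eq_same, if_true]
        omega
      · simp only [hbdef, hvdef, Pi.add_apply, Pi.single_eq_of_ne hij, add_zero, if_neg hij]
        omega
  -- the pair bound `(1 - cos(p·x))J_{0,x} + (1 - cos(p·(x+v)))J_{0,x+v} ≥ m`
  set g : Site d → ℝ := fun x => (1 - Real.cos (phase p x)) * J 0 x with hgdef
  have hpair : ∀ x ∈ X, m ≤ g x + g (x + v) := by
    intro x hx
    obtain ⟨⟨hne1, hl1⟩, ⟨hne2, hl2⟩⟩ := hb x hx
    have hJ1 := hJge x hne1 hl1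
    have hJ2 := hJge (x + v) hne2 hl2
    have hph : phase p (x + v) = phase p x + (k : ℝ) * p j := by
      rw [phase_add, hvdef, phase_single, hKdef, Int.cast_natCast]
    have hη : |(k : ℝ) * p j| = k * s := by rw [abs_mul, Nat.abs_cast, hj]
    have htrig := one_le_two_sub_cos_sub_cos (phase p x) (η := (k : ℝ) * p j) (by rw [hη]; exact hk1)
      (by rw [hη]; exact hk2)
    have hc1 : 0 ≤ 1 - Real.cos (phase p x) := sub_nonneg.2 (Real.cos_le_one _)
    have hc2 : 0 ≤ 1 - Real.cos (phase p (x + v)) := sub_nonneg.2 (Real.cos_le_one _)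
    calc m = 1 * m := (one_mul m).symm
      _ ≤ ((1 - Real.cos (phase p x)) + (1 - Real.cos (phase p x + k * p j))) * m :=
          mul_le_mul_of_nonneg_right htrig hm0
      _ = (1 - Real.cos (phase p x)) * m + (1 - Real.cos (phase p (x + v))) * m := by rw [hph]; ring
      _ ≤ g x + g (x + v) :=
          add_le_add (mul_le_mul_of_nonneg_left hJ1 hc1) (mul_le_mul_of_nonneg_left hJ2 hc2)
  -- summing over `X ∪ (X + v)`
  have hsumT : ∑ x ∈ X ∪ X.image (fun x => x + v), g x = ∑ x ∈ X, (g x + g (x + v)) := by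
    rw [Finset.sum_union hdisj, Finset.sum_image fun x _ y _ h => hinj h, Finset.sum_add_distrib]
  have hcardX : (k : ℝ) ^ d ≤ (X.card : ℝ) := by
    rw [hXdef, Fintype.card_piFinset]
    push_cast
    rw [show ((k : ℝ)) ^ d = ∏ _i : Fin d, (k : ℝ) by
      rw [Finset.prod_const, Finset.card_univ, Fintype.card_fin]]
    refine Finset.prod_le_prod (fun i _ => hk0.le) fun i _ => ?_
    have hK1 : Finset.card (Finset.Icc (1 : ℤ) K) = k := by
      rw [Int.card_Icc, hKdef]; simp
    have hK2 : Finset.card (Finset.Icc (-K) K) = 2 * k + 1 := by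
      rw [Int.card_Icc, hKdef, show (k : ℤ) + 1 - -(k : ℤ) = ((2 * k + 1 : ℕ) : ℤ) by push_cast; ring,
        Int.toNat_natCast]
    split_ifs
    · rw [hK1]
    · rw [hK2]; push_cast; linarith
  have hlow : (X.card : ℝ) * m ≤ ∑ x ∈ X ∪ X.image (fun x => x + v), g x := by
    rw [hsumT]
    have := Finset.card_nsmul_le_sum X (fun x => g x + g (x + v)) m hpair
    rwa [nsmul_eq_mul] at this
  have hfin := sum_le_one_sub_couplingFourier J hJ0 hs hpos p (X ∪ X.image fun x => x + v)
  -- the arithmetic `c s^α ≤ k^d m / |J|`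
  have hks : (Real.pi + 1) ^ (-α) * s ^ α ≤ (k : ℝ) ^ (-α) := by
    have h1 : ((Real.pi + 1) / s) ^ (-α) ≤ (k : ℝ) ^ (-α) :=
      Real.rpow_le_rpow_of_nonpos hk0 hkle (by linarith)
    have h2 : ((Real.pi + 1) / s) ^ (-α) = (Real.pi + 1) ^ (-α) * s ^ α := by
      rw [Real.div_rpow (by positivity) hs0.le, Real.rpow_neg hs0.le, div_inv_eq_mul]
    rwa [h2] at h1
  have hkm : (k : ℝ) ^ d * m = C₀ * ((d : ℝ) + 1) ^ (-((d : ℝ) + α)) * (k : ℝ) ^ (-α) := by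
    rw [hmdef, Real.mul_rpow (by positivity) hk0.le]
    have : (k : ℝ) ^ d * (k : ℝ) ^ (-((d : ℝ) + α)) = (k : ℝ) ^ (-α) := by
      rw [← Real.rpow_natCast, ← Real.rpow_add hk0]
      congr 1; ring
    calc (k : ℝ) ^ d * (C₀ * (((d : ℝ) + 1) ^ (-((d : ℝ) + α)) * (k : ℝ) ^ (-((d : ℝ) + α))))
        = C₀ * ((d : ℝ) + 1) ^ (-((d : ℝ) + α)) * ((k : ℝ) ^ d * (k : ℝ) ^ (-((d : ℝ) + α))) := by ring
      _ = _ := by rw [this]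
  calc c * s ^ α = C₀ * ((d : ℝ) + 1) ^ (-((d : ℝ) + α)) * ((Real.pi + 1) ^ (-α) * s ^ α) /
        couplingNorm J := by rw [hcdef]; ring
    _ ≤ C₀ * ((d : ℝ) + 1) ^ (-((d : ℝ) + α)) * (k : ℝ) ^ (-α) / couplingNorm J := by
        gcongr
    _ = (k : ℝ) ^ d * m / couplingNorm J := by rw [hkm]
    _ ≤ (X.card : ℝ) * m / couplingNorm J := by gcongr
    _ ≤ (∑ x ∈ X ∪ X.image (fun x => x + v), g x) / couplingNorm J :=
        div_le_div_of_nonneg_right hlow hpos.le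
    _ ≤ 1 - couplingFourier J p := hfin

/-! ### The global lower bound on the cube and the pointwise bound on the box -/

namespace LongRangeIsing

variable {d : ℕ}

/-- **`1 - Ĵ(q) ≥ c'‖q‖^{α∧2}` on the whole cube `‖q‖_∞ ≤ π`** for `J_{x,y} = C₀|x-y|₁^{-d-α}`, `α ≠ 2`
(the discharged small-momentum bound extended by the nearest-neighbour bound). [cite: Panis2023Triviality, §3.3 (display "1 - Ĵ(p) ≍ …") and Remark 3.5] -/
theorem exists_cube_gap_lower (hd : 1 ≤ d) {C₀ α : ℝ} (hC₀ : 0 < C₀) (hα : 0 < α) (hα2 : α ≠ 2) :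
    ∃ c' : ℝ, 0 < c' ∧ ∀ q : Fin d → ℝ, ‖q‖ ≤ Real.pi →
      c' * ‖q‖ ^ min α 2 ≤ 1 - couplingFourier (algebraicCoupling d C₀ α) q := by
  obtain ⟨c, r, hc, hr, hlow⟩ := panis_couplingFourierGap_lower_holds d hd C₀ α hC₀ hα hα2
  exact rpow_le_one_sub_couplingFourier_of_lower hd hC₀ hα (min_le_right _ _) hc hr hlow

/-- **The pointwise bound on the box**: for `p ∈ (-πn,πn]^d`, `n > 0`, a weight `N ≥ 0` and a cube
bound `1 - Ĵ(q) ≥ c'‖q‖^a`, `N/(1 - Ĵ(p/n)) ≤ (n^a/c') N ‖p‖^{-a}` (at `p = 0` both sides vanish, since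
`Ĵ(0) = 1` and `x/0 = 0`). [cite: Panis2023Triviality, proof of Proposition 3.8 (last paragraph)] -/
theorem div_gap_le {J : Site d → Site d → ℝ} (h0 : couplingNorm J ≠ 0) {a c' n : ℝ} (hc' : 0 < c')
    (hn : 0 < n) (hglob : ∀ q : Fin d → ℝ, ‖q‖ ≤ Real.pi → c' * ‖q‖ ^ a ≤ 1 - couplingFourier J q)
    {p : Fin d → ℝ} (hp : p ∈ momentumBox d n) {N : ℝ} (hN : 0 ≤ N) :
    N / (1 - couplingFourier J fun i => p i / n) ≤ n ^ a / c' * (N * ‖p‖ ^ (-a)) := by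
  by_cases hp0 : p = 0
  · subst hp0
    have h1 : (fun i : Fin d => (0 : Fin d → ℝ) i / n) = 0 := by funext i; simp
    rw [h1, couplingFourier_zero J h0, sub_self, div_zero]
    exact mul_nonneg (div_nonneg (Real.rpow_nonneg hn.le _) hc'.le)
      (mul_nonneg hN (Real.rpow_nonneg (norm_nonneg _) _))
  · set q : Fin d → ℝ := fun i => p i / n with hqdef
    have hqs : q = n⁻¹ • p := by
      funext i; simp [hqdef, div_eq_inv_mul]
    have hnq : ‖q‖ = ‖p‖ / n := by
      rw [hqs, norm_smul, norm_inv, Real.norm_eq_abs, abs_of_pos hn, div_eq_inv_mul]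
    have hp0' : 0 < ‖p‖ := norm_pos_iff.2 hp0
    have hq0 : 0 < ‖q‖ := by rw [hnq]; positivity
    have hqπ : ‖q‖ ≤ Real.pi := by
      refine (pi_norm_le_iff_of_nonneg Real.pi_pos.le).2 fun i => ?_
      have hpi := hp i (Set.mem_univ i)
      rw [Set.mem_Ioc] at hpi
      rw [Real.norm_eq_abs, hqdef]
      simp only
      rw [abs_div, abs_of_pos hn, div_le_iff₀ hn, abs_le]
      constructor <;> nlinarith [hpi.1, hpi.2, Real.pi_pos]
    have hD : c' * ‖q‖ ^ a ≤ 1 - couplingFourier J q := hglob q hqπ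
    have hDpos : 0 < c' * ‖q‖ ^ a := mul_pos hc' (Real.rpow_pos_of_pos hq0 _)
    calc N / (1 - couplingFourier J q) ≤ N / (c' * ‖q‖ ^ a) := div_le_div_of_nonneg_left hN hDpos hD
      _ = n ^ a / c' * (N * ‖p‖ ^ (-a)) := by
          rw [hnq, Real.div_rpow (norm_nonneg _) hn.le, Real.rpow_neg (norm_nonneg _)]
          field_simp

/-- For a nonzero site, `1 ≤ ‖x‖_∞`. [folklore] -/
theorem one_le_norm_of_ne_zero {x : Site d} (hx : x ≠ 0) : (1 : ℝ) ≤ ‖x‖ := by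
  rw [Site.norm_eq_supNorm]
  exact_mod_cast Nat.one_le_iff_ne_zero.2 fun h => hx (Site.supNorm_eq_zero_iff.1 h)

/-- The momentum box is measurable. [folklore] -/
theorem measurableSet_momentumBox (n : ℝ) : MeasurableSet (momentumBox d n) :=
  MeasurableSet.univ_pi fun _ => measurableSet_Ioc

end LongRangeIsing

/-! ### The assembly -/

/-- **`⟨σ₀σ_x⟩_β ≤ C/(β|x|^{d-α∧2})` from the kernel form of Proposition 3.8's first display** (the step
"The second part of the statement then follows from … the observation that `1 - Ĵ(k) ≳ ‖k‖₂²`" of the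
proof of Proposition 3.8, in its power-law form): on the box `(-π|x|,π|x|]^d`,
`W(p)/(1 - Ĵ(p/|x|)) ≤ (|x|^a/c') W(p)‖p‖^{-a}` (`a = α∧2`, cube lower bound
`exists_cube_gap_lower`), so the integral is at most `(|x|^a/c')∫_{ℝ^d}W(p)‖p‖^{-a}dp`, finite because
`a ≤ 2 < 3 ≤ d`. [cite: Panis2023Triviality, proof of Proposition 3.8 (last paragraph) and §3.3 (display for algebraic decay interactions)] -/
theorem panis_infraredBound_algebraic_beta_of_kernelForm (h38 : panis_prop38_kernelForm) :
    panis_infraredBound_algebraic_beta := by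
  intro d hd C₀ α hC₀ hα hα2
  have hd1 : 1 ≤ d := by omega
  set J := algebraicCoupling d C₀ α with hJdef
  set a : ℝ := min α 2 with hadef
  have ha0 : 0 < a := lt_min hα two_pos
  have had : a < d := by
    have h3 : (3 : ℝ) ≤ d := by exact_mod_cast hd
    linarith [min_le_right α 2]
  have hpos := couplingNorm_algebraic_pos hd1 hC₀ hα
  have hs := algebraicCoupling_zero_summable hd1 hC₀.le hα
  have hJ0 : ∀ y, 0 ≤ J 0 y := fun y => algebraicCoupling_nonneg hC₀.le α 0 y
  obtain ⟨C, hC, h38'⟩ := h38 d hd C₀ α hC₀ hα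
  obtain ⟨c', hc', hglob⟩ := exists_cube_gap_lower hd1 hC₀ hα hα2
  set K : ℝ := ∫ p, envelopeRiesz d a p with hKdef
  have hK0 : 0 ≤ K := integral_nonneg (envelopeRiesz_nonneg a)
  have hgi := integrable_envelopeRiesz hd1 ha0.le had
  refine ⟨C * (K / c' + 1), by positivity, fun β hβ hββc x hx => ?_⟩
  set n : ℝ := ‖x‖ with hndef
  have hn1 : 1 ≤ n := one_le_norm_of_ne_zero hx
  have hn0 : 0 < n := by linarith
  have hB := measurableSet_momentumBox (d := d) n
  set f : (Fin d → ℝ) → ℝ := fun p => envelope d p / (1 - couplingFourier J (fun i => p i / n)) with hfdef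
  have hint : ∫ p in momentumBox d n, f p ≤ n ^ a / c' * K := by
    have h1 : ∫ p in momentumBox d n, f p ≤ ∫ p in momentumBox d n, n ^ a / c' * envelopeRiesz d a p := by
      refine integral_mono_of_nonneg ?_ ((hgi.const_mul _).integrableOn) ?_
      · exact ae_of_all _ fun p => div_nonneg (envelope_nonneg p) (one_sub_couplingFourier_nonneg J hJ0 hs hpos _)
      · exact (ae_restrict_iff' hB).2 (ae_of_all _ fun p hp =>
          div_gap_le hpos.ne' hc' hn0 hglob hp (envelope_nonneg p))
    have h2 : ∫ p in momentumBox d n, n ^ a / c' * envelopeRiesz d a p ≤ n ^ a / c' * K := by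
      rw [integral_const_mul]
      refine mul_le_mul_of_nonneg_left ?_ (by positivity)
      exact setIntegral_le_integral hgi (ae_of_all _ (envelopeRiesz_nonneg a))
    exact h1.trans h2
  calc pairCorrelation J β 0 x ≤ C / (β * n ^ d) * ∫ p in momentumBox d n, f p := h38' β hβ hββc x hx
    _ ≤ C / (β * n ^ d) * (n ^ a / c' * K) := mul_le_mul_of_nonneg_left hint (by positivity)
    _ = C * (K / c') / (β * n ^ ((d : ℝ) - a)) := by
        rw [Real.rpow_sub hn0, Real.rpow_natCast]
        field_simp
    _ ≤ C * (K / c' + 1) / (β * n ^ ((d : ℝ) - a)) := by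
        gcongr
        linarith

/-- **The `§3.6` form from the `§3.3` form by monotonicity in `β`**: for `0 < β ≤ β_c`,
`⟨σ₀σ_x⟩_β ≤ ⟨σ₀σ_x⟩_{β_c} ≤ C/(β_c|x|^{d-α∧2})` (Griffiths II; "monotonicity in `β` of `S_β(x)`",
proof of Proposition 3.8), the factor `1/β_c` being absorbed into the constant; if `β_c = 0` the range
of `β` is empty. [cite: Panis2023Triviality, §3.6 (display "⟨τ₀τ_x⟩ ≤ C/β_c(ρ) |x|^{-(d-α∧2)}…") and proof of Proposition 3.8] -/
theorem panis_infraredBound_algebraic_of_beta (h : panis_infraredBound_algebraic_beta) :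
    panis_infraredBound_algebraic := by
  intro d hd C₀ α hC₀ hα hα2
  obtain ⟨C, hC, hb⟩ := h d hd C₀ α hC₀ hα hα2
  by_cases hβc : 0 < LongRangeIsing.criticalBeta (algebraicCoupling d C₀ α)
  · refine ⟨C / LongRangeIsing.criticalBeta (algebraicCoupling d C₀ α), div_pos hC hβc,
      fun β hβ hββc x hx => ?_⟩
    calc pairCorrelation (algebraicCoupling d C₀ α) β 0 x
        ≤ pairCorrelation (algebraicCoupling d C₀ α) (LongRangeIsing.criticalBeta (algebraicCoupling d C₀ α)) 0 x := by
          rw [pairCorrelation_eq, pairCorrelation_eq]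
          exact state_spinProduct_mono_beta _ (algebraicCoupling_nonneg hC₀.le α) hβ.le hββc _
      _ ≤ C / (LongRangeIsing.criticalBeta (algebraicCoupling d C₀ α) * ‖x‖ ^ ((d : ℝ) - min α 2)) :=
          hb _ hβc le_rfl x hx
      _ = C / LongRangeIsing.criticalBeta (algebraicCoupling d C₀ α) / ‖x‖ ^ ((d : ℝ) - min α 2) := by
          rw [div_div]
  · exact ⟨1, one_pos, fun β hβ hββc x hx => absurd (hβ.trans_le hββc) hβc⟩

/-- **The vendored fact `panis_infraredBound_algebraic` from the kernel form of Proposition 3.8's first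
display.** [cite: Panis2023Triviality, §3.6 (last display) with Proposition 3.8 and §3.3] -/
theorem panis_infraredBound_algebraic_of_kernelForm (h38 : panis_prop38_kernelForm) :
    panis_infraredBound_algebraic :=
  panis_infraredBound_algebraic_of_beta (panis_infraredBound_algebraic_beta_of_kernelForm h38)

end Literature.Barriers.CriticalPhenomena
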